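import Literature.Geometry.Kaehler.ComplexTorusHomologyExteriorModel
import HarnessLib

/-!
# `H_•(h; ℤ) = ⋀^• ρ_h`: functoriality of the identification `H_•(X, ℤ) ≅ ⋀^• Λ` under homomorphisms

Topic `Literature/Geometry/Kaehler` (complex tori `X = E/Φ(ℤ^ι)`, `Literature.Geometry.Kaehler.ComplexTorus`).
For a continuous ADDITIVE map `h : X₁ → X` of complex tori (e.g. a homomorphism `ρ(A)`), with
`ρ_h = topRep hh : Λ₁ → Λ` its action on the lattices (`= H₁(h; ℤ)` in the lattice bases,
`ComplexTorusFirstHomologyLattice.lean`; for `ρ(A)` the rational representation `A`, Lange §1.1.2):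

* `coe_homologyModelEquiv_one`: in degree one the comparison `Ψ : H₁(X; ℤ) ≅ ⋀¹ Λ` of
  `ComplexTorusHomologyExteriorModel.lean` is `y ↦ ι(L⁻¹ y)` (`L = latticeHOneEquiv Φ : Λ ≅ H₁(X; ℤ)`);
* `map_latticePontryaginMonomial_eq`: `h_*` is multiplicative on Pontryagin monomials (it commutes with
  `⋆ = μ_* ∘ ×`, `singularHomology.map_addPontryagin`);
* **`homologyModelEquiv_map`: `Ψ (H_{k+1}(h) x) = (⋀^{k+1} ρ_h) (Ψ x)`** — under `H_•(X, ℤ) ≅ ⋀^• Λ`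
  the induced map on ALL of singular homology is the exterior power of the lattice map `ρ_h = H₁(h)`
  (Lange 2023, §1.1.2–§1.1.3: `ρ_r` is the action on `Λ = H₁(X, ℤ)`; Exercise 1.1.6 (11)(a), (12): the
  Pontryagin ring `H_•(X, ℤ)` is generated by `H₁`; dually Lemma 1.1.17 / Exercise 1.1.6 (8) for cohomology).

Everything is proved; no definition, no named fact. As in `ComplexTorusHomologyExteriorModel.lean` the generic
`AddCommGroup.toIntModule` is switched off so that `⋀[ℤ]^n (ι → ℤ)` carries `Submodule.module`.

## References

* [Lange2023AbelianVarietiesComplex] H. Lange, *Abelian Varieties over the Complex Numbers* (2023),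
  §1.1.2 (rational representation `ρ_r`), §1.1.3 (1.3)–(1.4), Lemma 1.1.17, Exercise 1.1.6 (8), (11), (12);
  §2.5.3 (Pontryagin product).
* [HatcherAT2002] A. Hatcher, *Algebraic Topology* (2002), §3.C (Pontryagin product, naturality for H-maps).
-/

noncomputable section

open CategoryTheory Module
open Literature.AlgebraicTopology.SingularHomology Literature.AlgebraicTopology

universe u

namespace Literature.Geometry.Kaehler

namespace ComplexTorus

attribute [-instance] AddCommGroup.toIntModule

/-! ### Degree one: `Ψ(y) = ι(L⁻¹ y)` -/

section DegreeOne

variable {ι : Type} [Fintype ι] [DecidableEq ι] {E : Type} [NormedAddCommGroup E] [NormedSpace ℂ E]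
variable (Φ : (ι → ℝ) ≃L[ℝ] E)

/-- `hOneBasis Φ ℤ b = L(e_b)`. [cite: Lange2023AbelianVarietiesComplex, §1.1.3 (1.3)] -/
theorem hOneBasis_eq_latticeHOneEquiv_single (b : ι) :
    hOneBasis Φ ℤ b = latticeHOneEquiv Φ (Pi.single b 1) := by
  rw [hOneBasis_apply, latticeHOneEquiv_apply]

omit [Fintype ι] in
/-- A lattice cycle of length one is `ι(e_b)` in the exterior algebra. [cite: Lange2023AbelianVarietiesComplex, §2.5.3 (p. 133)] -/
theorem coe_latCycle_one (b : ι) :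
    ((latCycle (fun _ : Fin 1 ↦ b) : ⋀[ℤ]^1 (ι → ℤ)) : ExteriorAlgebra ℤ (ι → ℤ)) =
      ExteriorAlgebra.ι ℤ (Pi.single b (1 : ℤ) : ι → ℤ) := by
  rw [latCycle_eq, exteriorPower.ιMulti_apply_coe, ExteriorAlgebra.ιMulti_apply, List.ofFn_succ, List.ofFn_zero,
    List.prod_cons, List.prod_nil, mul_one]

/-- **In degree one `Ψ(y) = ι(L⁻¹ y)`**: the comparison `H₁(X; ℤ) ≅ ⋀¹ Λ` is the inverse of the lattice
isomorphism `L : Λ ≅ H₁(X; ℤ)` followed by `ι : Λ → ⋀^• Λ`. [cite: Lange2023AbelianVarietiesComplex, §1.1.3 (1.3); §2.5.3 (p. 133)] -/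
theorem coe_homologyModelEquiv_one (y : singularHomology ℤ ℤ (ComplexTorus Φ) 1) :
    ((homologyModelEquiv Φ 0 y : ⋀[ℤ]^1 (ι → ℤ)) : ExteriorAlgebra ℤ (ι → ℤ)) =
      ExteriorAlgebra.ι ℤ ((latticeHOneEquiv Φ).symm y) := by
  have key : (⋀[ℤ]^1 (ι → ℤ)).subtype ∘ₗ (homologyModelEquiv Φ 0).toLinearMap =
      ExteriorAlgebra.ι ℤ ∘ₗ (latticeHOneEquiv Φ).symm.toLinearMap := by
    refine (hOneBasis Φ ℤ).ext fun b ↦ ?_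
    rw [LinearMap.comp_apply, LinearMap.comp_apply, LinearEquiv.coe_toLinearMap, LinearEquiv.coe_toLinearMap,
      Submodule.subtype_apply, homologyModelEquiv_hOneBasis, coe_latCycle_one, hOneBasis_eq_latticeHOneEquiv_single,
      LinearEquiv.symm_apply_apply]
  exact LinearMap.congr_fun key y

end DegreeOne

/-! ### Functoriality under additive continuous maps -/

section Functorial

variable {ι₁ ι : Type} [Fintype ι₁] [Fintype ι] [DecidableEq ι₁] [DecidableEq ι] {E₁ E : Type}
  [NormedAddCommGroup E₁] [NormedSpace ℂ E₁] [NormedAddCommGroup E] [NormedSpace ℂ E]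
  {Φ₁ : (ι₁ → ℝ) ≃L[ℝ] E₁} {Φ : (ι → ℝ) ≃L[ℝ] E}
  {h : ComplexTorus Φ₁ → ComplexTorus Φ} (hh : Continuous h) (hadd : ∀ a b, h (a + b) = h a + h b)

omit [DecidableEq ι] in
/-- `H₁(h)(h(λ_{e_j})) = L(ρ_h e_j)`. [cite: Lange2023AbelianVarietiesComplex, §1.1.2 (`ρ_r`); §1.1.3 (1.3)] -/
theorem map_hOneBasis_eq_latticeHOneEquiv (j : ι₁) :
    singularHomology.map ℤ ℤ (⟨h, hh⟩ : C(ComplexTorus Φ₁, ComplexTorus Φ)) 1 (hOneBasis Φ₁ ℤ j) =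
      latticeHOneEquiv Φ ((topRep hh).mulVec (Pi.single j 1)) := by
  rw [hOneBasis_eq_latticeHOneEquiv_single, singularHomology_map_latticeHOneEquiv]

include hadd in
/-- **`h_*` of a lattice monomial, in the model**: `Ψ(h_*(h(λ_{w 0}) ⋆ ⋯ ⋆ h(λ_{w k}))) = ι(ρ_h e_{w 0}) ⋯ ι(ρ_h e_{w k})`
in `⋀^• Λ` (`h_*` commutes with `⋆`, `Ψ` is multiplicative). [cite: Lange2023AbelianVarietiesComplex, Exercise 1.1.6 (11)(a), (12); §1.1.2 (`ρ_r`)] -/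
theorem coe_homologyModelEquiv_map_latticePontryaginMonomial :
    ∀ (k : ℕ) (w : Fin (k + 1) → ι₁),
      ((homologyModelEquiv Φ k
          (singularHomology.map ℤ ℤ (⟨h, hh⟩ : C(ComplexTorus Φ₁, ComplexTorus Φ)) (k + 1)
            (latticePontryaginMonomial Φ₁ k w)) : ⋀[ℤ]^(k + 1) (ι → ℤ)) : ExteriorAlgebra ℤ (ι → ℤ)) =
        (List.ofFn fun i : Fin (k + 1) ↦
          ExteriorAlgebra.ι ℤ ((topRep hh).mulVec (Pi.single (w i) (1 : ℤ)))).prod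
  | 0, w => by
    rw [latticePontryaginMonomial_zero, map_hOneBasis_eq_latticeHOneEquiv, coe_homologyModelEquiv_one,
      LinearEquiv.symm_apply_apply, List.ofFn_succ, List.ofFn_zero, List.prod_cons, List.prod_nil, mul_one]
  | k + 1, w => by
    rw [latticePontryaginMonomial_succ, singularHomology.map_addPontryagin (⟨h, hh⟩ : C(ComplexTorus Φ₁, ComplexTorus Φ)) hadd,
      coe_homologyModelEquiv_addPontryagin Φ (rfl : k + 1 + (0 + 1) = k + 1 + 1),
      coe_homologyModelEquiv_map_latticePontryaginMonomial k (w ∘ Fin.castSucc), map_hOneBasis_eq_latticeHOneEquiv,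
      coe_homologyModelEquiv_one, LinearEquiv.symm_apply_apply, List.ofFn_succ' (n := k + 1), List.concat_eq_append,
      List.prod_append, List.prod_singleton]
    rfl

omit [DecidableEq ι] in
/-- The model side: `(⋀ᵏ⁺¹ ρ_h)(e_{w 0} ∧ ⋯ ∧ e_{w k}) = ι(ρ_h e_{w 0}) ⋯ ι(ρ_h e_{w k})` in `⋀^• Λ`.
[cite: Lange2023AbelianVarietiesComplex, §2.5.3 (p. 133)] -/
theorem coe_exteriorPower_map_latCycle (k : ℕ) (w : Fin (k + 1) → ι₁) :
    ((exteriorPower.map (k + 1) (topRep hh).mulVecLin (latCycle w) : ⋀[ℤ]^(k + 1) (ι → ℤ)) : ExteriorAlgebra ℤ (ι → ℤ)) =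
      (List.ofFn fun i : Fin (k + 1) ↦ ExteriorAlgebra.ι ℤ ((topRep hh).mulVec (Pi.single (w i) (1 : ℤ)))).prod := by
  rw [latCycle_eq, exteriorPower.map_apply_ιMulti, exteriorPower.ιMulti_apply_coe, ExteriorAlgebra.ιMulti_apply]
  rfl

include hadd in
/-- **`Ψ (h_* λ_w) = (⋀ᵏ⁺¹ ρ_h)(Ψ λ_w)`** on lattice monomials. [cite: Lange2023AbelianVarietiesComplex, Exercise 1.1.6 (11)(a), (12); §1.1.2 (`ρ_r`)] -/
theorem homologyModelEquiv_map_latticePontryaginMonomial (k : ℕ) (w : Fin (k + 1) → ι₁) :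
    homologyModelEquiv Φ k
        (singularHomology.map ℤ ℤ (⟨h, hh⟩ : C(ComplexTorus Φ₁, ComplexTorus Φ)) (k + 1) (latticePontryaginMonomial Φ₁ k w)) =
      exteriorPower.map (k + 1) (topRep hh).mulVecLin (homologyModelEquiv Φ₁ k (latticePontryaginMonomial Φ₁ k w)) := by
  apply Subtype.ext
  rw [coe_homologyModelEquiv_map_latticePontryaginMonomial hh hadd, homologyModelEquiv_latticePontryaginMonomial,
    coe_exteriorPower_map_latCycle]

include hadd in
/-- **`H_{k+1}(h; ℤ) = ⋀ᵏ⁺¹ ρ_h` under `H_•(X, ℤ) ≅ ⋀^• Λ`**: for a continuous additive map `h : X₁ → X` of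
complex tori and every class `x ∈ Hₖ₊₁(X₁; ℤ)`, `Ψ(h_* x) = (⋀ᵏ⁺¹ ρ_h)(Ψ x)`, `ρ_h = H₁(h; ℤ) : Λ₁ → Λ`
(for a homomorphism `ρ(A)` the rational representation `A`). [cite: Lange2023AbelianVarietiesComplex, §1.1.2 (`ρ_r`), §1.1.3 (1.3); Exercise 1.1.6 (11)(a), (12)] -/
theorem homologyModelEquiv_map (k : ℕ) (x : singularHomology ℤ ℤ (ComplexTorus Φ₁) (k + 1)) :
    homologyModelEquiv Φ k (singularHomology.map ℤ ℤ (⟨h, hh⟩ : C(ComplexTorus Φ₁, ComplexTorus Φ)) (k + 1) x) =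
      exteriorPower.map (k + 1) (topRep hh).mulVecLin (homologyModelEquiv Φ₁ k x) := by
  rw [eq_sum_zsmul_latticePontryaginMonomial Φ₁ k x]
  simp only [map_sum, map_zsmul, homologyModelEquiv_map_latticePontryaginMonomial hh hadd]

/-- The same for a homomorphism given as a continuous additive monoid homomorphism. [cite: Lange2023AbelianVarietiesComplex, §1.1.2 (`ρ_r`), §1.1.3 (1.3)] -/
theorem homologyModelEquiv_map_addMonoidHom (f : ComplexTorus Φ₁ →+ ComplexTorus Φ) (hf : Continuous f) (k : ℕ)
    (x : singularHomology ℤ ℤ (ComplexTorus Φ₁) (k + 1)) :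
    homologyModelEquiv Φ k (singularHomology.map ℤ ℤ (⟨f, hf⟩ : C(ComplexTorus Φ₁, ComplexTorus Φ)) (k + 1) x) =
      exteriorPower.map (k + 1) (topRep hf).mulVecLin (homologyModelEquiv Φ₁ k x) :=
  homologyModelEquiv_map hf (map_add f) k x

end Functorial

end ComplexTorus

end Literature.Geometry.Kaehler

end
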